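import Mathlib
import Summits.Ventures.HodgeRepro.Tier4.Common.LocalCoordinatesConj
import Summits.Ventures.HodgeRepro.Tier4.Line4.D3Coeff
import Summits.Ventures.HodgeRepro.Tier4.Line4.D3CoeffDecayConj
import Summits.Ventures.HodgeRepro.Tier4.Line4.D3CoeffInfOnly
import Summits.Ventures.HodgeRepro.Tier4.Line4.DefiniteCoeff
import Summits.Ventures.HodgeRepro.Tier4.Line4.TorusWeightLocal

/-!
# Tier4/Line4/LocSizeCutoff — the `ℓ¹` size `locSize w` of the `T′`-adapted `w`-block (bi-`T′_w`-invariant, continuous,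
sign-free comparison `archSizeAt w ≤ K_w · locSize w`, `locSizeBound`) and the bi-invariant CUTOFF `cutoff w R := max 0 (min 1 (R + 1 − locSize w))`
— the factor that makes the archimedean witness decay at EVERY real CM place off `w₀`, definite or not

Blind re-derivation cell `pub-hodge-repro`, Tier 4 (README §9–§10), seat t4-L1-p5 (prover, gen 5; self-cut C-L4-7A-NODEF
S15560: the `hdef`-free (7a) support lemma, module 1 of 3).  Target tree path
`lean/Summits/Ventures/HodgeRepro/Tier4/Line4/LocSizeCutoff.lean`.  On typer-2's `Common/LocalCoordinatesConj` (p700125),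
the seat's `D3Coeff` (p699431: `locEntry_off_diag_of_mem_torusT`), `D3CoeffDecay`/`D3CoeffDecayConj` (p701467 / p701824:
`sum_norm_entries_eq_blocks`, `norm_adToC_blockOf_le`, `sum_norm_adToC_mul_le`, `mat_eq_adMat_mul_mat_conjTo`),
`DefiniteCoeff` (p703816: `locEntry'_mul_of_mem_localTorusAt'_ne`, the torus weights), `TorusWeightLocal` (p706805),
L4-p1's `D3CoeffInfOnly` (p703420: `locEntry'_ofInfPart`); no printed input.

WHAT IS PROVED (kernel, no print).
* **`sum_norm_adToC_mat_le_sum_locEntry`** (row plane) — `∑ᵢⱼ ‖adToC w (mat g i j)‖ ≤ 4 · blockBound q w · ∑_{IJ} ‖locEntry g I J‖`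
  at every real CM place: the block-by-block comparison of p701467's `sum_norm_adToC_mat_le` BEFORE the `U(1,1)` relations
  enter (no sign hypothesis); **`archSizeAt_le_locSize`** (seesaw plane) — `∑ᵢⱼ ‖adToC w (mat x i j)‖ ≤ locSizeBound q a g g' w ·
  locSize w x` through `conjTo` (`mat x = adMat g · mat (conjTo x) · adMat g′`, `sum_norm_adToC_mul_le`).
* `locEntry'_torus'_mul` / `locEntry'_mul_torus'` — every entry: `ℓ′_{IJ}(κ x) = u_I(κ) ℓ′_{IJ}(x)`, `ℓ′_{IJ}(x κ) = ℓ′_{IJ}(x) u_J(κ)`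
  for `κ ∈ T′(𝔸)` (`locMat'_mul` + the diagonal torus block).
* **`locSize`** (def) with `continuous_locSize`, `locSize_nonneg`, `norm_locEntry'_le_locSize`, **`locSize_torus'_mul` /
  `locSize_mul_torus'`** (bi-`T′(𝔸)`-invariance), `locSize_mul_of_mem_localTorusAt'_ne` (the other places), `locSize_ofInfPart`.
* **`cutoff`** (def, `ℂ`-valued from the real `max 0 (min 1 (R + 1 − locSize w x))`) with `continuous_cutoff`,
  `norm_cutoff_le_one`, `cutoff_eq_one_of_le` (`locSize ≤ R`), **`locSize_lt_of_cutoff_ne_zero`** (`cutoff ≠ 0 → locSize < R + 1`),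
  `cutoff_torus'_mul` / `cutoff_mul_torus'` / `cutoff_mul_of_mem_localTorusAt'_ne` / `cutoff_ofInfPart`, and the `equiv`-shape
  `cj_cutoff_inv_mul` with weights `(0, 0)`.

Nothing here says anything about the status of the Hodge conjecture for CM abelian varieties, which is NOT proved
(HC_CM is NOT proved by anyone in this repository).
-/

set_option autoImplicit false

noncomputable section

namespace Summit.Ventures.HodgeRepro.Tier4.Line4

open Summit.Ventures.HodgeRepro.Tier4.Common Summit.Ventures.HodgeRepro.Tier4.Line1 NumberField Matrix

open scoped ComplexConjugate

section RowSize

variable {k : Type} [Field k] [NumberField k] (q : QuadData k) (a b ε : k) (w : InfinitePlace k)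
  (hw : w.IsReal) (hcm : IsCMAt q w)

include hw hcm in
/-- **the sign-free size comparison on the row plane**: `∑ᵢⱼ ‖adToC w (mat g i j)‖ ≤ 4 · blockBound q w · ∑_{IJ} ‖ℓ_{IJ}(g)‖`
(each `2×2` real block `blockOf t n x y` is bounded entrywise by `blockBound · ‖blockWeight x y‖ = blockBound · ‖ℓ_{IJ}‖`). -/
theorem sum_norm_adToC_mat_le_sum_locEntry (g : GA (PlaneData.ofLinesRow q a b ε)) :
    ∑ i : Fin 4, ∑ j : Fin 4, ‖adToC w (GA.mat (PlaneData.ofLinesRow q a b ε) g i j)‖ ≤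
      4 * blockBound q w * ∑ I : Fin 2, ∑ J : Fin 2, ‖locEntry q a b ε w g I J‖ := by
  set M := GA.mat (PlaneData.ofLinesRow q a b ε) g with hM
  rw [sum_norm_entries_eq_blocks]
  have hblock : ∀ I J : Fin 2, ∑ i : Fin 2, ∑ j : Fin 2, ‖adToC w (blocksOf M I J i j)‖ ≤
      4 * (blockBound q w * ‖locEntry q a b ε w g I J‖) := by
    intro I J
    have hentry : ∀ i j : Fin 2, ‖adToC w (blocksOf M I J i j)‖ ≤ blockBound q w * ‖locEntry q a b ε w g I J‖ := by
      intro i j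
      have hloc : locEntry q a b ε w g I J =
          blockWeight q w (M (lineBase I) (lineBase J)) (M (lineOmega I) (lineBase J)) := by
        rw [locEntry_eq_blockWeight, blocks_eq_blockOf, blockOf_apply_zero_zero, blockOf_apply_one_zero]
      rw [hloc, hM, blocks_eq_blockOf]
      exact norm_adToC_blockOf_le q hw hcm _ _ i j
    calc ∑ i : Fin 2, ∑ j : Fin 2, ‖adToC w (blocksOf M I J i j)‖
        ≤ ∑ i : Fin 2, ∑ j : Fin 2, blockBound q w * ‖locEntry q a b ε w g I J‖ :=
          Finset.sum_le_sum fun i _ => Finset.sum_le_sum fun j _ => hentry i j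
      _ = 4 * (blockBound q w * ‖locEntry q a b ε w g I J‖) := by simp; ring
  calc ∑ I : Fin 2, ∑ J : Fin 2, ∑ i : Fin 2, ∑ j : Fin 2, ‖adToC w (blocksOf M I J i j)‖
      ≤ ∑ I : Fin 2, ∑ J : Fin 2, 4 * (blockBound q w * ‖locEntry q a b ε w g I J‖) :=
        Finset.sum_le_sum fun I _ => Finset.sum_le_sum fun J _ => hblock I J
    _ = 4 * blockBound q w * ∑ I : Fin 2, ∑ J : Fin 2, ‖locEntry q a b ε w g I J‖ := by
        simp only [Finset.mul_sum]
        refine Finset.sum_congr rfl fun I _ => Finset.sum_congr rfl fun J _ => ?_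
        ring

end RowSize

section Size

variable {k : Type} [Field k] [NumberField k] (q : QuadData k) (a : Fin 4 → k)
  (g g' : Matrix (Fin 4) (Fin 4) k) (hgg' : g * g' = 1) (hg'g : g' * g = 1)
  (hgΩ : g * (PlaneData.mixedRow q (a 0) (a 2)).Ω = (PlaneData.mixedRow q (a 0) (a 2)).Ω * g)
  (lam : k) (hlam : lam ≠ 0)
  (hiso : g * (PlaneData.mixedRow q (a 1) (a 3)).B * gᵀ = lam • (PlaneData.mixedRow q (a 0) (a 2)).B)
  (w : InfinitePlace k)

/-- **the `ℓ¹` size of the `T′`-adapted `w`-block**: `∑_{IJ} ‖locEntry' w x I J‖`. -/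
def locSize (x : GA ((PlaneData.mixedRow q (a 0) (a 2)).withTransportedTorus g g' hgg' hg'g hgΩ)) : ℝ :=
  ∑ I : Fin 2, ∑ J : Fin 2, ‖locEntry' q a g g' hgg' hg'g hgΩ lam hiso w x I J‖

/-- `0 ≤ locSize`. -/
theorem locSize_nonneg (x : GA ((PlaneData.mixedRow q (a 0) (a 2)).withTransportedTorus g g' hgg' hg'g hgΩ)) :
    0 ≤ locSize q a g g' hgg' hg'g hgΩ lam hiso w x :=
  Finset.sum_nonneg fun _ _ => Finset.sum_nonneg fun _ _ => norm_nonneg _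

/-- every entry is bounded by the size. -/
theorem norm_locEntry'_le_locSize (x : GA ((PlaneData.mixedRow q (a 0) (a 2)).withTransportedTorus g g' hgg' hg'g hgΩ))
    (I J : Fin 2) :
    ‖locEntry' q a g g' hgg' hg'g hgΩ lam hiso w x I J‖ ≤ locSize q a g g' hgg' hg'g hgΩ lam hiso w x := by
  unfold locSize
  calc ‖locEntry' q a g g' hgg' hg'g hgΩ lam hiso w x I J‖
      ≤ ∑ J' : Fin 2, ‖locEntry' q a g g' hgg' hg'g hgΩ lam hiso w x I J'‖ :=
        Finset.single_le_sum (fun _ _ => norm_nonneg _) (Finset.mem_univ J)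
    _ ≤ ∑ I' : Fin 2, ∑ J' : Fin 2, ‖locEntry' q a g g' hgg' hg'g hgΩ lam hiso w x I' J'‖ :=
        Finset.single_le_sum (f := fun I' => ∑ J' : Fin 2, ‖locEntry' q a g g' hgg' hg'g hgΩ lam hiso w x I' J'‖)
          (fun _ _ => Finset.sum_nonneg fun _ _ => norm_nonneg _) (Finset.mem_univ I)

/-- `locSize` is continuous. -/
theorem continuous_locSize : Continuous (locSize q a g g' hgg' hg'g hgΩ lam hiso w) :=
  continuous_finsetSum _ fun I _ => continuous_finsetSum _ fun J _ =>
    (continuous_locEntry' q a g g' hgg' hg'g hgΩ lam hiso w I J).norm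

/-- the size constant of the seesaw plane at `w`: `‖adMat g‖₁ · ‖adMat g′‖₁ · 4 · blockBound q w`. -/
def locSizeBound : ℝ :=
  (∑ i : Fin 4, ∑ j : Fin 4, ‖adToC w (adMat k g i j)‖) * (∑ i : Fin 4, ∑ j : Fin 4, ‖adToC w (adMat k g' i j)‖) *
    (4 * blockBound q w)

/-- `0 ≤ locSizeBound`. -/
theorem locSizeBound_nonneg : 0 ≤ locSizeBound q g g' w := by
  unfold locSizeBound
  have h1 : 0 ≤ ∑ i : Fin 4, ∑ j : Fin 4, ‖adToC w (adMat k g i j)‖ :=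
    Finset.sum_nonneg fun _ _ => Finset.sum_nonneg fun _ _ => norm_nonneg _
  have h2 : 0 ≤ ∑ i : Fin 4, ∑ j : Fin 4, ‖adToC w (adMat k g' i j)‖ :=
    Finset.sum_nonneg fun _ _ => Finset.sum_nonneg fun _ _ => norm_nonneg _
  have h3 := blockBound_nonneg q w
  positivity

include hlam in
/-- **THE SIGN-FREE SIZE COMPARISON on the seesaw plane**: at every real CM place `w`,
`∑ᵢⱼ ‖adToC w (mat x i j)‖ ≤ locSizeBound q g g' w · locSize w x`. -/
theorem archSizeAt_le_locSize (hw : w.IsReal) (hcm : IsCMAt q w)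
    (x : GA ((PlaneData.mixedRow q (a 0) (a 2)).withTransportedTorus g g' hgg' hg'g hgΩ)) :
    ∑ i : Fin 4, ∑ j : Fin 4,
        ‖adToC w (GA.mat ((PlaneData.mixedRow q (a 0) (a 2)).withTransportedTorus g g' hgg' hg'g hgΩ) x i j)‖ ≤
      locSizeBound q g g' w * locSize q a g g' hgg' hg'g hgΩ lam hiso w x := by
  have _hlam := hlam
  rw [mat_eq_adMat_mul_mat_conjTo q a g g' hgg' hg'g hgΩ lam hiso x]
  unfold locSizeBound locSize
  set N := GA.mat (PlaneData.ofLinesRow q (a 1) (a 3) (-1)) (conjTo q a g g' hgg' hg'g hgΩ lam hiso x) with hN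
  set Sg := ∑ i : Fin 4, ∑ j : Fin 4, ‖adToC w (adMat k g i j)‖ with hSg
  set Sg' := ∑ i : Fin 4, ∑ j : Fin 4, ‖adToC w (adMat k g' i j)‖ with hSg'
  have hSg0 : 0 ≤ Sg := Finset.sum_nonneg fun _ _ => Finset.sum_nonneg fun _ _ => norm_nonneg _
  have hSg'0 : 0 ≤ Sg' := Finset.sum_nonneg fun _ _ => Finset.sum_nonneg fun _ _ => norm_nonneg _
  have hrow : ∑ i : Fin 4, ∑ j : Fin 4, ‖adToC w (N i j)‖ ≤
      4 * blockBound q w * ∑ I : Fin 2, ∑ J : Fin 2, ‖locEntry' q a g g' hgg' hg'g hgΩ lam hiso w x I J‖ :=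
    sum_norm_adToC_mat_le_sum_locEntry q (a 1) (a 3) (-1) w hw hcm (conjTo q a g g' hgg' hg'g hgΩ lam hiso x)
  calc ∑ i : Fin 4, ∑ j : Fin 4, ‖adToC w ((adMat k g * N * adMat k g') i j)‖
      ≤ (∑ i : Fin 4, ∑ j : Fin 4, ‖adToC w ((adMat k g * N) i j)‖) * Sg' := sum_norm_adToC_mul_le w _ _
    _ ≤ (Sg * ∑ i : Fin 4, ∑ j : Fin 4, ‖adToC w (N i j)‖) * Sg' :=
        mul_le_mul_of_nonneg_right (sum_norm_adToC_mul_le w _ _) hSg'0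
    _ ≤ (Sg * (4 * blockBound q w * ∑ I : Fin 2, ∑ J : Fin 2, ‖locEntry' q a g g' hgg' hg'g hgΩ lam hiso w x I J‖)) *
          Sg' := mul_le_mul_of_nonneg_right (mul_le_mul_of_nonneg_left hrow hSg0) hSg'0
    _ = Sg * Sg' * (4 * blockBound q w) * ∑ I : Fin 2, ∑ J : Fin 2,
          ‖locEntry' q a g g' hgg' hg'g hgΩ lam hiso w x I J‖ := by ring

include hlam in
/-- **every entry is `T′`-equivariant on the left**: `ℓ′_{IJ}(κ x) = u_I(κ) · ℓ′_{IJ}(x)` for `κ ∈ T′(𝔸)`. -/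
theorem locEntry'_torus'_mul (hw : w.IsReal) (hcm : IsCMAt q w) (ha1 : a 1 ≠ 0) (ha3 : a 3 ≠ 0)
    (x κ : GA ((PlaneData.mixedRow q (a 0) (a 2)).withTransportedTorus g g' hgg' hg'g hgΩ))
    (hκ : κ ∈ torusT' ((PlaneData.mixedRow q (a 0) (a 2)).withTransportedTorus g g' hgg' hg'g hgΩ)) (I J : Fin 2) :
    locEntry' q a g g' hgg' hg'g hgΩ lam hiso w (κ * x) I J =
      weightAt' ((PlaneData.mixedRow q (a 0) (a 2)).withTransportedTorus g g' hgg' hg'g hgΩ) q w g g' I κ *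
        locEntry' q a g g' hgg' hg'g hgΩ lam hiso w x I J := by
  have hoff := locEntry_off_diag_of_mem_torusT q (a 1) (a 3) (-1) w ha1 ha3 (by norm_num) _
    (conjTo_mem_torusT_of_mem_torusT' q a g g' hgg' hg'g hgΩ lam hlam hiso hκ)
  have hmul := congrFun (congrFun (locMat'_mul q a g g' hgg' hg'g hgΩ lam hiso w hw hcm κ x) I) J
  rw [locMat'_apply, Matrix.mul_apply, Fin.sum_univ_two, locMat'_apply, locMat'_apply, locMat'_apply, locMat'_apply]
    at hmul
  rw [hmul, ← locEntry'_diag_eq_weightAt' q a g g' hgg' hg'g hgΩ lam hiso w κ I]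
  fin_cases I
  · have h01 : locEntry' q a g g' hgg' hg'g hgΩ lam hiso w κ 0 1 = 0 := by
      unfold locEntry'; exact hoff.1
    simp [h01]
  · have h10 : locEntry' q a g g' hgg' hg'g hgΩ lam hiso w κ 1 0 = 0 := by
      unfold locEntry'; exact hoff.2
    simp [h10]

include hlam in
/-- **every entry is `T′`-equivariant on the right**: `ℓ′_{IJ}(x κ) = ℓ′_{IJ}(x) · u_J(κ)` for `κ ∈ T′(𝔸)`. -/
theorem locEntry'_mul_torus' (hw : w.IsReal) (hcm : IsCMAt q w) (ha1 : a 1 ≠ 0) (ha3 : a 3 ≠ 0)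
    (x κ : GA ((PlaneData.mixedRow q (a 0) (a 2)).withTransportedTorus g g' hgg' hg'g hgΩ))
    (hκ : κ ∈ torusT' ((PlaneData.mixedRow q (a 0) (a 2)).withTransportedTorus g g' hgg' hg'g hgΩ)) (I J : Fin 2) :
    locEntry' q a g g' hgg' hg'g hgΩ lam hiso w (x * κ) I J =
      locEntry' q a g g' hgg' hg'g hgΩ lam hiso w x I J *
        weightAt' ((PlaneData.mixedRow q (a 0) (a 2)).withTransportedTorus g g' hgg' hg'g hgΩ) q w g g' J κ := by
  have hoff := locEntry_off_diag_of_mem_torusT q (a 1) (a 3) (-1) w ha1 ha3 (by norm_num) _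
    (conjTo_mem_torusT_of_mem_torusT' q a g g' hgg' hg'g hgΩ lam hlam hiso hκ)
  have hmul := congrFun (congrFun (locMat'_mul q a g g' hgg' hg'g hgΩ lam hiso w hw hcm x κ) I) J
  rw [locMat'_apply, Matrix.mul_apply, Fin.sum_univ_two, locMat'_apply, locMat'_apply, locMat'_apply, locMat'_apply]
    at hmul
  rw [hmul, ← locEntry'_diag_eq_weightAt' q a g g' hgg' hg'g hgΩ lam hiso w κ J]
  fin_cases J
  · have h10 : locEntry' q a g g' hgg' hg'g hgΩ lam hiso w κ 1 0 = 0 := by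
      unfold locEntry'; exact hoff.2
    simp [h10]
  · have h01 : locEntry' q a g g' hgg' hg'g hgΩ lam hiso w κ 0 1 = 0 := by
      unfold locEntry'; exact hoff.1
    simp [h01]

include hlam in
/-- **`locSize` is left-`T′(𝔸)`-invariant** (`|u_I(κ)| = 1`). -/
theorem locSize_torus'_mul (hw : w.IsReal) (hcm : IsCMAt q w) (ha1 : a 1 ≠ 0) (ha3 : a 3 ≠ 0)
    (x κ : GA ((PlaneData.mixedRow q (a 0) (a 2)).withTransportedTorus g g' hgg' hg'g hgΩ))
    (hκ : κ ∈ torusT' ((PlaneData.mixedRow q (a 0) (a 2)).withTransportedTorus g g' hgg' hg'g hgΩ)) :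
    locSize q a g g' hgg' hg'g hgΩ lam hiso w (κ * x) = locSize q a g g' hgg' hg'g hgΩ lam hiso w x := by
  unfold locSize
  refine Finset.sum_congr rfl fun I _ => Finset.sum_congr rfl fun J _ => ?_
  rw [locEntry'_torus'_mul q a g g' hgg' hg'g hgΩ lam hlam hiso w hw hcm ha1 ha3 x κ hκ I J, norm_mul,
    norm_weightAt'_eq_one_of_mem_torusT' q a g g' hgg' hg'g hgΩ lam hlam hiso w hw hcm ha1 ha3 I hκ, one_mul]

include hlam in
/-- **`locSize` is right-`T′(𝔸)`-invariant**. -/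
theorem locSize_mul_torus' (hw : w.IsReal) (hcm : IsCMAt q w) (ha1 : a 1 ≠ 0) (ha3 : a 3 ≠ 0)
    (x κ : GA ((PlaneData.mixedRow q (a 0) (a 2)).withTransportedTorus g g' hgg' hg'g hgΩ))
    (hκ : κ ∈ torusT' ((PlaneData.mixedRow q (a 0) (a 2)).withTransportedTorus g g' hgg' hg'g hgΩ)) :
    locSize q a g g' hgg' hg'g hgΩ lam hiso w (x * κ) = locSize q a g g' hgg' hg'g hgΩ lam hiso w x := by
  unfold locSize
  refine Finset.sum_congr rfl fun I _ => Finset.sum_congr rfl fun J _ => ?_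
  rw [locEntry'_mul_torus' q a g g' hgg' hg'g hgΩ lam hlam hiso w hw hcm ha1 ha3 x κ hκ I J, norm_mul,
    norm_weightAt'_eq_one_of_mem_torusT' q a g g' hgg' hg'g hgΩ lam hlam hiso w hw hcm ha1 ha3 J hκ, mul_one]

include hlam in
/-- the other places' tori act trivially on `locSize w`. -/
theorem locSize_mul_of_mem_localTorusAt'_ne (hw : w.IsReal) (hcm : IsCMAt q w) {w' : InfinitePlace k} (hne : w' ≠ w)
    {κ : GA ((PlaneData.mixedRow q (a 0) (a 2)).withTransportedTorus g g' hgg' hg'g hgΩ)}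
    (hκ : κ ∈ localTorusAt' ((PlaneData.mixedRow q (a 0) (a 2)).withTransportedTorus g g' hgg' hg'g hgΩ) w')
    (x : GA ((PlaneData.mixedRow q (a 0) (a 2)).withTransportedTorus g g' hgg' hg'g hgΩ)) :
    locSize q a g g' hgg' hg'g hgΩ lam hiso w (κ * x) = locSize q a g g' hgg' hg'g hgΩ lam hiso w x := by
  unfold locSize
  refine Finset.sum_congr rfl fun I _ => Finset.sum_congr rfl fun J _ => ?_
  rw [locEntry'_mul_of_mem_localTorusAt'_ne q a g g' hgg' hg'g hgΩ lam hlam hiso w hw hcm hne hκ x I J]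

/-- `locSize` reads the archimedean coordinate only. -/
theorem locSize_ofInfPart (x : GA ((PlaneData.mixedRow q (a 0) (a 2)).withTransportedTorus g g' hgg' hg'g hgΩ)) :
    locSize q a g g' hgg' hg'g hgΩ lam hiso w (GA.ofInfPart _ x) = locSize q a g g' hgg' hg'g hgΩ lam hiso w x := by
  unfold locSize
  refine Finset.sum_congr rfl fun I _ => Finset.sum_congr rfl fun J _ => ?_
  rw [locEntry'_ofInfPart]

end Size

section Cutoff

variable {k : Type} [Field k] [NumberField k] (q : QuadData k) (a : Fin 4 → k)
  (g g' : Matrix (Fin 4) (Fin 4) k) (hgg' : g * g' = 1) (hg'g : g' * g = 1)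
  (hgΩ : g * (PlaneData.mixedRow q (a 0) (a 2)).Ω = (PlaneData.mixedRow q (a 0) (a 2)).Ω * g)
  (lam : k) (hlam : lam ≠ 0)
  (hiso : g * (PlaneData.mixedRow q (a 1) (a 3)).B * gᵀ = lam • (PlaneData.mixedRow q (a 0) (a 2)).B)
  (w : InfinitePlace k) (R : ℝ)

/-- **the bi-invariant cutoff at `w`**: `max 0 (min 1 (R + 1 − locSize w x))` as a complex number — `1` where
`locSize ≤ R`, `0` where `locSize ≥ R + 1`, continuous, bi-`T′_w`-invariant. -/
def cutoff (x : GA ((PlaneData.mixedRow q (a 0) (a 2)).withTransportedTorus g g' hgg' hg'g hgΩ)) : ℂ :=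
  ((max 0 (min 1 (R + 1 - locSize q a g g' hgg' hg'g hgΩ lam hiso w x)) : ℝ) : ℂ)

/-- `cutoff` is continuous. -/
theorem continuous_cutoff : Continuous (cutoff q a g g' hgg' hg'g hgΩ lam hiso w R) :=
  Complex.continuous_ofReal.comp
    (continuous_const.max (continuous_const.min (continuous_const.sub (continuous_locSize q a g g' hgg' hg'g hgΩ lam hiso w))))

/-- `‖cutoff x‖ ≤ 1`. -/
theorem norm_cutoff_le_one (x : GA ((PlaneData.mixedRow q (a 0) (a 2)).withTransportedTorus g g' hgg' hg'g hgΩ)) :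
    ‖cutoff q a g g' hgg' hg'g hgΩ lam hiso w R x‖ ≤ 1 := by
  unfold cutoff
  rw [Complex.norm_real, Real.norm_eq_abs, abs_of_nonneg (le_max_left _ _)]
  exact max_le zero_le_one (min_le_left _ _)

/-- `cutoff = 1` where `locSize ≤ R`. -/
theorem cutoff_eq_one_of_le {x : GA ((PlaneData.mixedRow q (a 0) (a 2)).withTransportedTorus g g' hgg' hg'g hgΩ)}
    (h : locSize q a g g' hgg' hg'g hgΩ lam hiso w x ≤ R) : cutoff q a g g' hgg' hg'g hgΩ lam hiso w R x = 1 := by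
  unfold cutoff
  have h1 : min 1 (R + 1 - locSize q a g g' hgg' hg'g hgΩ lam hiso w x) = 1 := min_eq_left (by linarith)
  rw [h1, max_eq_right zero_le_one, Complex.ofReal_one]

/-- **the support of the cutoff**: `cutoff x ≠ 0 → locSize w x < R + 1`. -/
theorem locSize_lt_of_cutoff_ne_zero {x : GA ((PlaneData.mixedRow q (a 0) (a 2)).withTransportedTorus g g' hgg' hg'g hgΩ)}
    (h : cutoff q a g g' hgg' hg'g hgΩ lam hiso w R x ≠ 0) :
    locSize q a g g' hgg' hg'g hgΩ lam hiso w x < R + 1 := by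
  by_contra hcon
  have hcon' : R + 1 ≤ locSize q a g g' hgg' hg'g hgΩ lam hiso w x := not_lt.1 hcon
  apply h
  unfold cutoff
  have h1 : min 1 (R + 1 - locSize q a g g' hgg' hg'g hgΩ lam hiso w x) ≤ 0 := by
    refine (min_le_right _ _).trans ?_
    linarith
  rw [max_eq_left h1, Complex.ofReal_zero]

include hlam in
/-- `cutoff` is left-`T′(𝔸)`-invariant. -/
theorem cutoff_torus'_mul (hw : w.IsReal) (hcm : IsCMAt q w) (ha1 : a 1 ≠ 0) (ha3 : a 3 ≠ 0)
    (x κ : GA ((PlaneData.mixedRow q (a 0) (a 2)).withTransportedTorus g g' hgg' hg'g hgΩ))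
    (hκ : κ ∈ torusT' ((PlaneData.mixedRow q (a 0) (a 2)).withTransportedTorus g g' hgg' hg'g hgΩ)) :
    cutoff q a g g' hgg' hg'g hgΩ lam hiso w R (κ * x) = cutoff q a g g' hgg' hg'g hgΩ lam hiso w R x := by
  unfold cutoff
  rw [locSize_torus'_mul q a g g' hgg' hg'g hgΩ lam hlam hiso w hw hcm ha1 ha3 x κ hκ]

include hlam in
/-- `cutoff` is right-`T′(𝔸)`-invariant. -/
theorem cutoff_mul_torus' (hw : w.IsReal) (hcm : IsCMAt q w) (ha1 : a 1 ≠ 0) (ha3 : a 3 ≠ 0)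
    (x κ : GA ((PlaneData.mixedRow q (a 0) (a 2)).withTransportedTorus g g' hgg' hg'g hgΩ))
    (hκ : κ ∈ torusT' ((PlaneData.mixedRow q (a 0) (a 2)).withTransportedTorus g g' hgg' hg'g hgΩ)) :
    cutoff q a g g' hgg' hg'g hgΩ lam hiso w R (x * κ) = cutoff q a g g' hgg' hg'g hgΩ lam hiso w R x := by
  unfold cutoff
  rw [locSize_mul_torus' q a g g' hgg' hg'g hgΩ lam hlam hiso w hw hcm ha1 ha3 x κ hκ]

include hlam in
/-- the other places' tori act trivially on `cutoff w`. -/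
theorem cutoff_mul_of_mem_localTorusAt'_ne (hw : w.IsReal) (hcm : IsCMAt q w) {w' : InfinitePlace k} (hne : w' ≠ w)
    {κ : GA ((PlaneData.mixedRow q (a 0) (a 2)).withTransportedTorus g g' hgg' hg'g hgΩ)}
    (hκ : κ ∈ localTorusAt' ((PlaneData.mixedRow q (a 0) (a 2)).withTransportedTorus g g' hgg' hg'g hgΩ) w')
    (x : GA ((PlaneData.mixedRow q (a 0) (a 2)).withTransportedTorus g g' hgg' hg'g hgΩ)) :
    cutoff q a g g' hgg' hg'g hgΩ lam hiso w R (κ * x) = cutoff q a g g' hgg' hg'g hgΩ lam hiso w R x := by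
  unfold cutoff
  rw [locSize_mul_of_mem_localTorusAt'_ne q a g g' hgg' hg'g hgΩ lam hlam hiso w hw hcm hne hκ x]

/-- `cutoff` reads the archimedean coordinate only. -/
theorem cutoff_ofInfPart (x : GA ((PlaneData.mixedRow q (a 0) (a 2)).withTransportedTorus g g' hgg' hg'g hgΩ)) :
    cutoff q a g g' hgg' hg'g hgΩ lam hiso w R (GA.ofInfPart _ x) = cutoff q a g g' hgg' hg'g hgΩ lam hiso w R x := by
  unfold cutoff
  rw [locSize_ofInfPart]

include hlam in
/-- the `equiv` shape of the cutoff at `w`: weights `(0, 0)`. -/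
theorem cj_cutoff_inv_mul (hw : w.IsReal) (hcm : IsCMAt q w) (ha1 : a 1 ≠ 0) (ha3 : a 3 ≠ 0)
    {κ : GA ((PlaneData.mixedRow q (a 0) (a 2)).withTransportedTorus g g' hgg' hg'g hgΩ)}
    (hκ : κ ∈ localTorusAt' ((PlaneData.mixedRow q (a 0) (a 2)).withTransportedTorus g g' hgg' hg'g hgΩ) w)
    (y : GA ((PlaneData.mixedRow q (a 0) (a 2)).withTransportedTorus g g' hgg' hg'g hgΩ)) :
    RTF.cj (cutoff q a g g' hgg' hg'g hgΩ lam hiso w R) (κ⁻¹ * y) =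
      weightAt' ((PlaneData.mixedRow q (a 0) (a 2)).withTransportedTorus g g' hgg' hg'g hgΩ) q w g g' 0 κ ^ (-(0 : ℤ)) *
        weightAt' ((PlaneData.mixedRow q (a 0) (a 2)).withTransportedTorus g g' hgg' hg'g hgΩ) q w g g' 1 κ ^ (-(0 : ℤ)) *
        RTF.cj (cutoff q a g g' hgg' hg'g hgΩ lam hiso w R) y := by
  have hκT' : κ⁻¹ ∈ torusT' ((PlaneData.mixedRow q (a 0) (a 2)).withTransportedTorus g g' hgg' hg'g hgΩ) :=
    (torusT' _).inv_mem hκ.1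
  unfold RTF.cj
  rw [cutoff_torus'_mul q a g g' hgg' hg'g hgΩ lam hlam hiso w R hw hcm ha1 ha3 y κ⁻¹ hκT', neg_zero, zpow_zero,
    zpow_zero, one_mul, one_mul]

end Cutoff

end Summit.Ventures.HodgeRepro.Tier4.Line4

end
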